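import Summits.ResolutionOfSingularities.ResolutionOfSingularities.Theorems.SplitTowerGen
import Literature.AlgebraicGeometry.Resolution.BoundaryRestriction

/-!
# SplitTower (T8/·) — THE CHART LAWS III: the fibre line, the new split shape at the origin, the closed law

Node «SplitTower» of `decomp-res-lens-2` (g34), see `Theorems/MaxContactCutSplitTower.lean`.

Setting as in T6: `D` a split shape over the local ring `A` (frame `c`, curve prime `𝔓 = (c)`), a chart `j`, a prime
`𝔴 ⊆ B_j` over `𝔪_A` (a CLOSED point of the blow-up over the closed point of `A`), `S = (B_j)_𝔴`, `χ`, `σ`,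
`t = σ c_j`, `J' = (J S : tⁿ)`.

* §L `le_span_sup_of_origin` — the closed origin `𝔴₀ ∋ e_l` satisfies `𝔴₀ ⊆ (e_l : l ≠ j) + 𝔪_A B_j`.
* §F `SplitShape.fibre_line` — CORE TYPE (`Gᵢ ∈ 𝔪_A`), `e₀ ∈ 𝔴`, off the origin of the `W`-chart: `J' ⊆ 𝔪_Sⁿ`
  forces `τ(J') ≥ 2` (`ϖ`-adic normal forms of the `Gᵢ` modulo `𝔓` + `fibreLine_two_le_tau` of T1).
* §O `SplitShape.origin` — AT THE ORIGIN of the `W`-chart (`e₀, e₁ ∈ 𝔴`) the controlled transform carries a split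
  shape again, with frame `(χ e₀, χ e₁, t; σ w)`, curve prime `𝔴̃₀ S` (the origin over `𝔓`, T7) and exponent `k − n`:
  THE WEIGHT IDEAL REPRODUCES (`split_factor_W`).
* §C `SplitShape.closed_law` — THE CLOSED LAW: `J' ⊆ 𝔪_Sⁿ ⇒ τ(J') ≥ 2 ∨ (j = 2 ∧ e₀, e₁ ∈ 𝔴)` (unit type:
  `notPow_chart`; core type: `core_chart_top` / `fibre_line`).

Sources: [Hironaka1964] Ch. III §3; [CossartJannsenSaito2020] Ch. 2, Ch. 8; [Matsumura1987] Thms. 14.2, 17.10.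
-/

open IsLocalRing
open Literature.AlgebraicGeometry.Resolution
open Summit.ResolutionOfSingularities.ResolutionOfSingularities.Theorems.SplitCut (splitCone MiddleCoeff VertexTame)
open Summit.ResolutionOfSingularities.ResolutionOfSingularities.Theorems.JetCut (WtIdeal)
open Summit.ResolutionOfSingularities.ResolutionOfSingularities.Theorems.PurityCut (BinomGuard)
open Summit.ResolutionOfSingularities.ResolutionOfSingularities.Theorems.TowerCut (mem_colon_of_map_eq
  colon_le_of_le_span_pow_mul)

namespace Summit.ResolutionOfSingularities.ResolutionOfSingularities.Theorems.SplitTower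

variable {A : Type} [CommRing A] [IsLocalRing A]

/-! ## §L  The closed origin -/

section ClosedOrigin

open MvPolynomial

/-- **The closed origin lies in `(e_l : l ≠ j) + 𝔪_A B_j`**: a prime `𝔴` of `B_j` over `𝔪_A` containing every `e_l`,
`l ≠ j`. [folklore] -/
theorem le_span_sup_of_origin {m : ℕ} (c : Fin m → A) (j : Fin m) (hq : IsQuasiRegular c)
    (hcm : ∀ l, c l ∈ maximalIdeal A) {𝔴 : Ideal (chartRing c j)} [𝔴.IsPrime]
    (h𝔴 : 𝔴.comap (chartBase c j) = maximalIdeal A) (hgen : ∀ l, l ≠ j → chartGen c j l ∈ 𝔴) :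
    𝔴 ≤ Ideal.span (Set.range fun l : {i : Fin m // i ≠ j} => chartGen c j l.1) ⊔
      (maximalIdeal A).map (chartBase c j) := by
  classical
  intro b hb
  obtain ⟨-, hrefl⟩ := map_fibreMap_isPrime c j hq hcm (𝔴 := 𝔴) h𝔴
  set F := fibreMap c j hq hcm b with hF
  obtain ⟨a, ha⟩ := residue_surjective (constantCoeff F)
  have hXle : Ideal.span (Set.range (X : _ → MvPolynomial {i : Fin m // i ≠ j} (ResidueField A))) =
      (Ideal.span (Set.range fun l : {i : Fin m // i ≠ j} => chartGen c j l.1)).map (fibreMap c j hq hcm) := by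
    rw [Ideal.map_span, ← Set.range_comp]
    exact congrArg _ (congrArg _ (funext fun l => (fibreMap_gen c j hq hcm l.2).symm))
  -- the constant coefficient of `F` vanishes: `C(F(0)) = Φ(φ a) ∈ Φ(𝔴)` forces `a ∈ 𝔪_A`
  have h1 : F - C (constantCoeff F) ∈ 𝔴.map (fibreMap c j hq hcm) := by
    have hX : F - C (constantCoeff F) ∈ Ideal.span (Set.range (X : _ → MvPolynomial _ (ResidueField A))) :=
      mem_span_X_of_constantCoeff (by simp)
    rw [hXle] at hX
    exact Ideal.map_mono (Ideal.span_le.mpr (by rintro _ ⟨⟨l, hl⟩, rfl⟩; exact hgen l hl)) hX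
  have h2 : C (constantCoeff F) ∈ 𝔴.map (fibreMap c j hq hcm) :=
    (Submodule.sub_mem_iff_right _ ((hrefl b).mp hb)).mp h1
  rw [← ha, ← fibreMap_base c j hq hcm, ← hrefl, ← Ideal.mem_comap, h𝔴, ← residue_eq_zero_iff, ha] at h2
  have h3 : F ∈ (Ideal.span (Set.range fun l : {i : Fin m // i ≠ j} => chartGen c j l.1)).map (fibreMap c j hq hcm) := by
    rw [← hXle]; exact mem_span_X_of_constantCoeff h2
  have h4 := Ideal.mem_comap.mpr h3
  rw [Ideal.comap_map_of_surjective _ (fibreMap_surjective c j hq hcm)] at h4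
  refine (sup_le le_sup_left ?_ : _ ⊔ Ideal.comap _ ⊥ ≤ _) h4
  rw [← RingHom.ker_eq_comap_bot]
  exact (ker_fibreMap_le_map c j hq hcm).trans le_sup_right

end ClosedOrigin

variable {J P : Ideal A} {n k : ℕ}

/-! ## §F  The fibre line of a core point -/

section FibreLine

/-- **THE FIBRE LINE LAW**: `D` a split shape of CORE TYPE (`Gᵢ ∈ 𝔪_A`, `1 ≤ i ≤ n`), `𝔴` a closed point of the
`u`- or `W`-chart with `e₀ ∈ 𝔴`, NOT the origin of the `W`-chart (`j = 2 ⇒ e₁ ∉ 𝔴`): if `J' ⊆ 𝔪_Sⁿ` then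
`τ(J') ≥ 2`.  Write `Gᵢ = uᵢ ϖ^{mᵢ} + rᵢ` (`uᵢ` zero or a unit, `rᵢ ∈ 𝔓`; at the middle index `G_j = u ϖᵉ`
exactly); in `S` the `σ rᵢ` are multiples of `t`, so the chart numerator is
`Σ (σuᵢ·Uⁱ)(σϖ)^{mᵢ}(χe₀)^{n−i} + t·r` with `(t, σϖ, χe₀)` regular parameters: `fibreLine_two_le_tau`.
[cite: Hironaka1964, Ch. III §3] [cite: CossartJannsenSaito2020, Ch. 8] -/
theorem SplitShape.fibre_line (D : SplitShape J P n k) (hn : 2 ≤ n) (hnk : n ≤ k)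
    (hcore : ∀ i, 0 < i → i ≤ n → D.G i ∈ maximalIdeal A) (j : Fin 3) (hj : j ≠ 0)
    (𝔴 : PrimeSpectrum (chartRing D.c j)) {S : Type} [CommRing S] [IsLocalRing S] (χ : chartRing D.c j →+* S)
    (hlocχ : @IsLocalization.AtPrime _ _ S _ χ.toAlgebra 𝔴.asIdeal _)
    (h𝔴 : 𝔴.asIdeal.comap (chartBase D.c j) = maximalIdeal A) (σ : A →+* S) (hσ : ∀ x, χ (chartBase D.c j x) = σ x)
    (h0 : chartGen D.c j 0 ∈ 𝔴.asIdeal) (h1 : j = 2 → chartGen D.c j 1 ∉ 𝔴.asIdeal)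
    (hle : Submodule.colon (J.map σ) ((Ideal.span {σ (D.c j)} ^ n : Ideal S) : Set S) ≤ maximalIdeal S ^ n)
    {d : ℕ} (y : Fin d → S) (hy : Ideal.span (Set.range y) = maximalIdeal S) :
    2 ≤ hironakaTauAt y (Submodule.colon (J.map σ) ((Ideal.span {σ (D.c j)} ^ n : Ideal S) : Set S)) n := by
  classical
  haveI := D.isRegularLocalRing
  letI := χ.toAlgebra
  haveI : IsLocalization.AtPrime S 𝔴.asIdeal := hlocχ
  obtain ⟨hu, hloc, hχ, hujj⟩ := chart_dict D.c j 𝔴 χ hlocχ h𝔴 σ hσ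
  have halg : (algebraMap (chartRing D.c j) S : chartRing D.c j →+* S) = χ := RingHom.algebraMap_toAlgebra χ
  obtain ⟨j₀, e, u₀, hj₀, hj₀n, hej, hu₀, hGj, -⟩ := D.mid
  -- `ϖ`-adic normal forms of the coefficients modulo the curve, exact at the middle index
  have hdec : ∀ i, ∃ (m : ℕ) (u r : A), (u = 0 ∨ IsUnit u) ∧ r ∈ Ideal.span (Set.range D.c) ∧
      D.G i = u * D.ϖ ^ m + r ∧ (i = j₀ → IsUnit u ∧ m ≤ j₀) := fun i => by
    by_cases hi : i = j₀
    · subst hi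
      exact ⟨e, u₀, 0, Or.inr hu₀, zero_mem _, by rw [hGj, add_zero], fun _ => ⟨hu₀, hej⟩⟩
    · obtain ⟨m, u, r, hu, hr, hG⟩ := exists_unit_mul_pow_add D.c D.ϖ (D.core_span hcore) (D.G i)
      exact ⟨m, u, r, hu, hr, hG, fun h => absurd h hi⟩
  choose m u r hur hr hG hmid using hdec
  -- in `S` the curve generators are multiples of `t`
  have hσc : (Ideal.span (Set.range D.c)).map σ ≤ Ideal.span {σ (D.c j)} := by
    rw [Ideal.map_span, Ideal.span_le]
    rintro _ ⟨_, ⟨l, rfl⟩, rfl⟩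
    rw [SetLike.mem_coe, hu l]
    exact Ideal.mul_mem_right _ _ (Ideal.mem_span_singleton_self _)
  choose s hs using fun i => Ideal.mem_span_singleton'.mp (hσc (Ideal.mem_map_of_mem σ (hr i)))
  -- the chart factorisation `σ f = tⁿ (splitCone (χe₀) U (σG) n + t r₁)` with `U` a unit
  have hex : ∃ (U r₁ : S), IsUnit U ∧ σ (splitCone (D.c 0) (D.c 1) D.G n + D.ε * D.c 2 ^ k + D.h) =
      σ (D.c j) ^ n * (splitCone (χ (chartGen D.c j 0)) U (fun i => σ (D.G i)) n + σ (D.c j) * r₁) := by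
    obtain rfl | rfl | rfl : j = 0 ∨ j = 1 ∨ j = 2 := by fin_cases j <;> simp
    · exact absurd rfl hj
    · obtain ⟨r₁, hr₁⟩ := split_factor_U σ D.c (σ (D.c 1)) (fun l => χ (chartGen D.c 1 l)) D.G D.ε D.h hu hujj
        (D.succ_le hnk) D.tail
      exact ⟨1, r₁, isUnit_one, hr₁⟩
    · obtain ⟨r₁, hr₁⟩ := split_factor_W' σ D.c (σ (D.c 2)) (fun l => χ (chartGen D.c 2 l)) D.G D.ε D.h hu hujj
        (D.succ_le hnk) D.tail
      exact ⟨χ (chartGen D.c 2 1), r₁, notMem_maximalIdeal.mp fun hm => h1 rfl ((hχ _).mp hm), hr₁⟩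
  obtain ⟨U, r₁, hU, hfac⟩ := hex
  set t := σ (D.c j) with ht
  set x₀ := χ (chartGen D.c j 0) with hx₀
  have hterm : ∀ i, σ (D.G i) * x₀ ^ (n - i) * U ^ i =
      (σ (u i) * U ^ i) * σ D.ϖ ^ m i * x₀ ^ (n - i) + t * (s i * x₀ ^ (n - i) * U ^ i) := fun i => by
    rw [hG i, map_add, map_mul, map_pow, ← hs i]; ring
  have hH : splitCone x₀ U (fun i => σ (D.G i)) n + t * r₁ =
      (∑ i ∈ Finset.range (n + 1), (σ (u i) * U ^ i) * σ D.ϖ ^ m i * x₀ ^ (n - i)) +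
        t * (r₁ + ∑ i ∈ Finset.range (n + 1), s i * x₀ ^ (n - i) * U ^ i) := by
    simp only [splitCone]
    rw [Finset.sum_congr rfl fun i _ => hterm i, Finset.sum_add_distrib, ← Finset.mul_sum]; ring
  have hF : (∑ i ∈ Finset.range (n + 1), (σ (u i) * U ^ i) * σ D.ϖ ^ m i * x₀ ^ (n - i)) +
      t * (r₁ + ∑ i ∈ Finset.range (n + 1), s i * x₀ ^ (n - i) * U ^ i) ∈
        Submodule.colon (J.map σ) ((Ideal.span {σ (D.c j)} ^ n : Ideal S) : Set S) := by
    rw [← hH]; exact mem_colon_of_map_eq σ D.mem_ideal hfac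
  have htpx : IsRsopPart ![t, σ D.ϖ, x₀] := by
    have h := isRsopPart_fibre_chart (R := A) D.c D.ϖ (D.core_span hcore) D.finrank_eq j 𝔴 S h𝔴 hj.symm h0
    simpa only [halg, hσ] using h
  haveI := htpx.isRegularLocalRing
  refine fibreLine_two_le_tau htpx (le_trans (by norm_num) hn) (fun i => σ (u i) * U ^ i) m (fun i => ?_) hj₀n
    ((hmid j₀ rfl).1.map σ |>.mul (hU.pow _)) (hmid j₀ rfl).2 ?_ hle hF y hy
  · rcases hur i with h0i | hui
    · exact Or.inl (by rw [h0i, map_zero, zero_mul])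
    · exact Or.inr ((hui.map σ).mul (hU.pow i))
  · rw [← map_natCast σ, hloc]; exact D.guard j₀ hj₀ hj₀n

end FibreLine

/-! ## §O  The new split shape at the origin of the `W`-chart -/

section Origin

/-- `Fin.append ![a, b, c] ![d] = ![a, b, c, d]`. [folklore] -/
theorem append_three_one {α : Type} (a b c d : α) : Fin.append ![a, b, c] ![d] = ![a, b, c, d] := by
  funext i
  fin_cases i <;> rfl

omit [IsLocalRing A] in
/-- The span of the frame `(χ e₀, χ e₁, t)` is the extension `𝔴̃₀ S` of the origin over `𝔓`. [folklore] -/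
theorem span_frame_eq_map_originP (c : Fin 3 → A) {S : Type} [CommRing S] (χ : chartRing c 2 →+* S) (σ : A →+* S)
    (hσ : ∀ x, χ (chartBase c 2 x) = σ x) :
    Ideal.span (Set.range ![χ (chartGen c 2 0), χ (chartGen c 2 1), σ (c 2)]) = (originP c 2).map χ := by
  rw [map_originP c 2 χ σ hσ]
  refine congrArg Ideal.span (Set.ext fun x => ?_)
  simp only [Set.mem_range, Set.mem_union, Set.mem_singleton_iff]
  constructor
  · rintro ⟨i, rfl⟩
    fin_cases i
    · exact Or.inl ⟨⟨0, by decide⟩, rfl⟩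
    · exact Or.inl ⟨⟨1, by decide⟩, rfl⟩
    · exact Or.inr rfl
  · rintro (⟨⟨l, hl⟩, rfl⟩ | rfl)
    · obtain rfl | rfl | rfl : l = 0 ∨ l = 1 ∨ l = 2 := by fin_cases l <;> simp
      · exact ⟨0, rfl⟩
      · exact ⟨1, rfl⟩
      · exact absurd rfl hl
    · exact ⟨2, rfl⟩

/-- **THE SPLIT SHAPE REPRODUCES AT THE ORIGIN OF THE `W`-CHART, with exponent `k − n`**: `D` a split shape
(`n ≤ k`), `𝔴 ∋ e₀, e₁` a closed point of the `W`-chart, `S = (B₂)_𝔴`: the controlled transform `(J S : tⁿ)` carries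
a split shape with frame `(χe₀, χe₁, t; σw)`, curve prime `𝔴̃₀ S`, the same cone coefficients, and the tail in
`Wt(χe₀, χe₁, t; n, k − n)` (`split_factor_W`). [cite: Hironaka1964, Ch. III §3] [cite: CossartJannsenSaito2020, Ch. 8] -/
theorem SplitShape.origin (D : SplitShape J P n k) (hnk : n ≤ k) (𝔴 : PrimeSpectrum (chartRing D.c 2))
    {S : Type} [CommRing S] [IsLocalRing S] (χ : chartRing D.c 2 →+* S)
    (hlocχ : @IsLocalization.AtPrime _ _ S _ χ.toAlgebra 𝔴.asIdeal _)
    (h𝔴 : 𝔴.asIdeal.comap (chartBase D.c 2) = maximalIdeal A) (σ : A →+* S) (hσ : ∀ x, χ (chartBase D.c 2 x) = σ x)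
    (h0 : chartGen D.c 2 0 ∈ 𝔴.asIdeal) (h1 : chartGen D.c 2 1 ∈ 𝔴.asIdeal) :
    Nonempty (SplitShape (Submodule.colon (J.map σ) ((Ideal.span {σ (D.c 2)} ^ n : Ideal S) : Set S))
      ((originP D.c 2).map χ) n (k - n)) := by
  classical
  haveI := D.isRegularLocalRing
  letI := χ.toAlgebra
  haveI : IsLocalization.AtPrime S 𝔴.asIdeal := hlocχ
  obtain ⟨hu, hloc, hχ, hujj⟩ := chart_dict D.c 2 𝔴 χ hlocχ h𝔴 σ hσ
  have halg : (algebraMap (chartRing D.c 2) S : chartRing D.c 2 →+* S) = χ := RingHom.algebraMap_toAlgebra χ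
  -- the frame `(χe₀, χe₁, t, σw)` is part of a regular system of parameters of `S`
  have hrsop : IsRsopPart ![χ (chartGen D.c 2 0), χ (chartGen D.c 2 1), σ (D.c 2), σ D.w] := by
    have h := isRsopPart_origin_chart (R := A) D.c ![D.w] (by rw [range_append_one]; exact D.span_cw)
      D.finrank_eq 𝔴 S h𝔴 h0 h1 0
    simpa only [halg, hσ, Matrix.cons_val_zero] using h
  haveI : IsRegularLocalRing S := hrsop.isRegularLocalRing
  have ht0 : σ (D.c 2) ∈ nonZeroDivisors S := by simpa using hrsop.mem_nonZeroDivisors 2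
  -- the factorisation `σ f = tⁿ f'`, the weight ideal reproducing
  obtain ⟨h', hh', hfac⟩ := split_factor_W σ D.c (σ (D.c 2)) (fun l => χ (chartGen D.c 2 l)) D.G D.ε D.h hu hujj hnk
    D.tail
  -- the maximal ideal of `S` in the new frame
  have h𝔴le := le_span_sup_of_origin D.c 2 D.rsop.isQuasiRegular (fun l => D.le_maximalIdeal (D.span_c.le
    (Ideal.subset_span ⟨l, rfl⟩))) (𝔴 := 𝔴.asIdeal) h𝔴 (fun l hl => by
      obtain rfl | rfl | rfl : l = 0 ∨ l = 1 ∨ l = 2 := by fin_cases l <;> simp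
      exacts [h0, h1, absurd rfl hl])
  have hmS : ∀ v, Ideal.span (Set.range D.c ∪ {v}) = maximalIdeal A →
      Ideal.span (Set.range ![χ (chartGen D.c 2 0), χ (chartGen D.c 2 1), σ (D.c 2)] ∪ {σ v}) = maximalIdeal S :=
      fun v hv => by
    apply le_antisymm
    · rw [Ideal.span_le]
      rintro x (⟨i, rfl⟩ | rfl)
      · fin_cases i
        · exact (hχ _).mpr h0
        · exact (hχ _).mpr h1
        · exact (hloc _).mpr (D.le_maximalIdeal (D.span_c.le (Ideal.subset_span ⟨2, rfl⟩)))
      · exact (hloc _).mpr (hv.le (Ideal.subset_span (Or.inr rfl)))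
    · rw [← IsLocalization.AtPrime.map_eq_maximalIdeal 𝔴.asIdeal S, halg]
      refine (Ideal.map_mono h𝔴le).trans ?_
      rw [Ideal.map_sup, Ideal.map_span, Ideal.map_map, show χ.comp (chartBase D.c 2) = σ from RingHom.ext hσ, ← hv,
        Ideal.map_span]
      refine sup_le (Ideal.span_le.mpr ?_) (Ideal.span_le.mpr ?_)
      · rintro _ ⟨_, ⟨⟨l, hl⟩, rfl⟩, rfl⟩
        obtain rfl | rfl | rfl : l = 0 ∨ l = 1 ∨ l = 2 := by fin_cases l <;> simp
        · exact Ideal.subset_span (Or.inl ⟨0, rfl⟩)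
        · exact Ideal.subset_span (Or.inl ⟨1, rfl⟩)
        · exact absurd rfl hl
      · rintro _ ⟨x, (⟨l, rfl⟩ | rfl), rfl⟩
        · rw [SetLike.mem_coe, hu l]
          exact Ideal.mul_mem_right _ _ (Ideal.subset_span (Or.inl ⟨2, rfl⟩))
        · exact Ideal.subset_span (Or.inr rfl)
  refine ⟨{
      c := ![χ (chartGen D.c 2 0), χ (chartGen D.c 2 1), σ (D.c 2)]
      w := σ D.w
      ϖ := σ D.ϖ
      G := fun i => σ (D.G i)
      ε := σ D.ε
      h := h'
      rsop_cw := by rw [append_three_one]; exact hrsop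
      span_c := span_frame_eq_map_originP D.c χ σ hσ
      span_cw := hmS D.w D.span_cw
      ideal := ?_
      G_zero := by simp only [D.G_zero, map_one]
      mid := ?_
      vtx := ?_
      unit := D.unit.map σ
      tail := hh'
      ndvd := ?_
      guard := fun i hi hin => by rw [← map_natCast σ, hloc]; exact D.guard i hi hin }⟩
  rotate_right
  · rintro ⟨q, hq⟩
    exact D.ndvd ⟨q + 1, by rw [Nat.mul_succ, ← hq, Nat.sub_add_cancel hnk]⟩
  · -- `J' = (f')`
    show _ = Ideal.span {splitCone (χ (chartGen D.c 2 0)) (χ (chartGen D.c 2 1)) (fun i => σ (D.G i)) n +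
      σ D.ε * σ (D.c 2) ^ (k - n) + h'}
    apply le_antisymm
    · refine colon_le_of_le_span_pow_mul ht0 ?_
      rw [congrArg (Ideal.map σ) D.ideal, Ideal.map_span, Set.image_singleton, hfac,
        ← Ideal.span_singleton_mul_span_singleton]
    · rw [Ideal.span_le, Set.singleton_subset_iff]
      exact mem_colon_of_map_eq σ D.mem_ideal hfac
  · obtain ⟨j₀, e, u₀, hj₀, hj₀n, hej, hu₀, hGj, hϖ⟩ := D.mid
    refine ⟨j₀, e, σ u₀, hj₀, hj₀n, hej, hu₀.map σ, by simp only [hGj, map_mul, map_pow], ?_⟩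
    rcases hϖ with hspan | hunit
    · exact Or.inl (hmS D.ϖ hspan)
    · exact Or.inr (hunit.map σ)
  · rcases D.vtx with h | ⟨j₀, hj₀, hj₀n, hu₀⟩
    · exact Or.inl ((hloc _).mpr h)
    · exact Or.inr ⟨j₀, hj₀, hj₀n, hu₀.map σ⟩

end Origin

/-! ## §C  The closed law -/

section Closed

/-- **THE CLOSED LAW of a split shape**: at a closed point `𝔴` of any chart, if the controlled transform `J' = (J S : tⁿ)`
lies in `𝔪_Sⁿ` then EITHER `τ(J') ≥ 2` (in every regular system of parameters of `S`) OR the point is the origin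
of the `W`-chart (`j = 2`, `e₀, e₁ ∈ 𝔴`) — where the split shape reproduces (`SplitShape.origin`).
[cite: Hironaka1964, Ch. III §3] [cite: CossartJannsenSaito2020, Ch. 8] -/
theorem SplitShape.closed_law (D : SplitShape J P n k) (hn : 2 ≤ n) (hnk : n ≤ k) (j : Fin 3)
    (𝔴 : PrimeSpectrum (chartRing D.c j)) {S : Type} [CommRing S] [IsLocalRing S] (χ : chartRing D.c j →+* S)
    (hlocχ : @IsLocalization.AtPrime _ _ S _ χ.toAlgebra 𝔴.asIdeal _)
    (h𝔴 : 𝔴.asIdeal.comap (chartBase D.c j) = maximalIdeal A) (σ : A →+* S) (hσ : ∀ x, χ (chartBase D.c j x) = σ x)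
    (hle : Submodule.colon (J.map σ) ((Ideal.span {σ (D.c j)} ^ n : Ideal S) : Set S) ≤ maximalIdeal S ^ n) :
    (∀ {d : ℕ} (y : Fin d → S), Ideal.span (Set.range y) = maximalIdeal S →
      2 ≤ hironakaTauAt y (Submodule.colon (J.map σ) ((Ideal.span {σ (D.c j)} ^ n : Ideal S) : Set S)) n) ∨
      (j = 2 ∧ ∀ l, l ≠ j → chartGen D.c j l ∈ 𝔴.asIdeal) := by
  classical
  have hcm : ∀ l, D.c l ∈ maximalIdeal A := fun l => D.le_maximalIdeal (D.span_c.le (Ideal.subset_span ⟨l, rfl⟩))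
  have hn1 : 1 ≤ n := le_trans (by norm_num) hn
  rcases D.unit_or_core with ⟨i, hi0, hin, hui⟩ | hcore
  · exact Or.inr (notPow_chart D.c D.rsop.isQuasiRegular hcm D.mem_ideal D.tail hn1 (D.succ_le hnk) D.G_zero
      (notPow_of_unit D.guard hi0 hin hui) j 𝔴 χ hlocχ h𝔴 σ hσ hle)
  · rcases core_chart_top D.c D.mem_ideal D.tail (D.succ_le hnk) D.G_zero hcore hcm j 𝔴 χ hlocχ h𝔴 σ hσ with
      htop | ⟨hj, h0⟩
    · exfalso
      rw [htop, top_le_iff, Ideal.eq_top_iff_one] at hle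
      exact (Ideal.pow_le_self (by omega) |>.trans_lt (lt_top_iff_ne_top.mpr (maximalIdeal.isMaximal S).ne_top)).ne
        (Ideal.eq_top_iff_one _ |>.mpr hle)
    · by_cases horg : j = 2 ∧ ∀ l, l ≠ j → chartGen D.c j l ∈ 𝔴.asIdeal
      · exact Or.inr horg
      · refine Or.inl fun y hy => D.fibre_line hn hnk hcore j hj 𝔴 χ hlocχ h𝔴 σ hσ h0 (fun hj2 he1 => horg ⟨hj2, ?_⟩)
          hle y hy
        subst hj2
        intro l hl
        obtain rfl | rfl | rfl : l = 0 ∨ l = 1 ∨ l = 2 := by fin_cases l <;> simp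
        exacts [h0, he1, absurd rfl hl]

end Closed

end Summit.ResolutionOfSingularities.ResolutionOfSingularities.Theorems.SplitTower
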